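import Mathlib
import HarnessLib
import Summits.HubbardSuperconductivity.HubbardSuperconductivity.Theorems.KLProgrammePerturbedFermiCurveHigherDerivsCurve

/-!
# The frame's Fermi-point map `γ = toLp ∘ k_F^K`: PER-ORDER graded jets from per-order radius jets («(C1)-DEEP supplier», file 3a)

Cell `gate-hubbard-kl`, seat hubbard-kl-k3c3-p3 (g11; row «implicit-function / monotonicity route»), `--supports stmt-HubbardSuperconductivity-20437`;
pen (R79).  `…PerturbedFermiCurveHigherDerivsCurve` (k3c3-p3 g2) packages the curve jets through ONE graded constant `‖Dⁱγ‖ ≤ (4D₀D)ⁱ`; the graded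
(C1) door `flowPiece_reading_remainder_jets_oneCall_bell` (…JacksonRemainderOneCallGraded) wants them ORDER BY ORDER, because at deep reading scales
the flow frame's radius jets `u_K‴, u_K⁗` grow (`∝ A₃ ≍ 4ⁿ`, `A₄ ≍ 16ⁿ`) while `u_K′, u_K″` do not.  Leibniz for `u•dir` with `‖Dᵏdir‖ ≤ 1` and
`‖toLp‖ ≤ 2` gives, for `1 ≤ i ≤ 4`,

  `‖γ^{(i)}(θ)‖ ≤ 2·Σ_{k ≤ i} C(i,k)·U_k`   whenever `|u_K^{(k)}(θ)| ≤ U_k` (`k ≤ i`)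

(`norm_iteratedDeriv_fermiPointLp_le_perOrder`), i.e. `D 1 = 2(U₀+U₁)`, `D 2 = 2(U₀+2U₁+U₂)`, `D 3 = 2(U₀+3U₁+3U₂+U₃)`, `D 4 = 2(U₀+4U₁+6U₂+4U₃+U₄)`
(`fermiPointLp_graded_jets`) — LINEAR in each radius jet, so the growth of `U₃, U₄` stays in `D 3, D 4`.  Proved; no definitions; nothing about the model.
-/

noncomputable section

namespace Summit.HubbardSuperconductivity.HubbardSuperconductivity.Theorems.PerturbedFermiCurve

set_option linter.dupNamespace false -- summit = problem name (single-conjunct summit), D-0017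

open Real Set Finset
open Literature.MathematicalPhysics.QuantumLattice Literature.MathematicalPhysics.QuantumLattice.BandSectorCounting
open Summit.HubbardSuperconductivity.HubbardSuperconductivity.Theorems.DispersionFlow
open Summit.HubbardSuperconductivity.HubbardSuperconductivity.Theorems.KLRegimeSplit

section Curve

variable {a b : ℝ} (B : BandBounds a b) {K : TrigPolyC4v} {A : ℝ}
  (hA : ∀ p : Momentum, ∀ j ≤ 2, ‖iteratedFDeriv ℝ j (frameShift K) p‖ ≤ A) (hADt : 2 * A < B.Dtmin)
  {μ : ℝ} (hlo : a ≤ μ - A) (hhi : μ + A ≤ b)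
include B hA hADt hlo hhi

/-- **Per-order graded curve jets from per-order radius jets.**  With `u_K = perturbedFermiRadius δ_K μ` and `|u_K^{(k)}(θ)| ≤ U k` for `k ≤ i`
(`k = 0` is the radius itself): `‖γ^{(i)}(θ)‖ ≤ 2·Σ_{k ≤ i} C(i,k)·U k` for `γ θ = toLp 2 (klFermiPoint μ K θ)`, `1 ≤ i ≤ 4`. -/
theorem norm_iteratedDeriv_fermiPointLp_le_perOrder {θ : ℝ} {Uk : ℕ → ℝ} {i : ℕ} (hi4 : i ≤ 4)
    (hU : ∀ k ≤ i, |iteratedDeriv k (perturbedFermiRadius (fun p : Fin 2 → ℝ => -K.eval p) μ) θ| ≤ Uk k) :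
    ‖iteratedDeriv i (fun θ : ℝ => (WithLp.toLp 2 (klFermiPoint μ K θ) : Momentum)) θ‖ ≤
      2 * ∑ k ∈ range (i + 1), (i.choose k : ℝ) * Uk k := by
  rw [← norm_iteratedFDeriv_eq_norm_iteratedDeriv]
  set u := perturbedFermiRadius (fun p : Fin 2 → ℝ => -K.eval p) μ with hudef
  set T := ((EuclideanSpace.equiv (Fin 2) ℝ).symm : (Fin 2 → ℝ) →L[ℝ] Momentum) with hT
  have hγ : (fun θ : ℝ => (WithLp.toLp 2 (klFermiPoint μ K θ) : Momentum)) = T ∘ fun θ => u θ • dir θ := by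
    funext ϑ; simp [hT, klFermiPoint, hudef]
  have hu4 : ContDiff ℝ 4 u := contDiff_klFermiRadius B hA hADt hlo hhi (m := 4)
  have hf4 : ContDiff ℝ 4 (fun θ => u θ • dir θ) := hu4.smul contDiff_dir
  rw [hγ, T.iteratedFDeriv_comp_left hf4.contDiffAt (by exact_mod_cast hi4)]
  refine (T.norm_compContinuousMultilinearMap_le _).trans ?_
  have hu_k : ∀ k ≤ i, ‖iteratedFDeriv ℝ k u θ‖ ≤ Uk k := by
    intro k hk
    rw [norm_iteratedFDeriv_eq_norm_iteratedDeriv, Real.norm_eq_abs]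
    exact hU k hk
  have hL := norm_iteratedFDeriv_smul_le (N := ((4 : ℕ) : WithTop ℕ∞)) hu4 contDiff_dir θ (n := i) (by exact_mod_cast hi4)
  have hterm : ∀ k ∈ range (i + 1), (i.choose k : ℝ) * ‖iteratedFDeriv ℝ k u θ‖ * ‖iteratedFDeriv ℝ (i - k) dir θ‖ ≤
      (i.choose k : ℝ) * Uk k := by
    intro k hk
    have hki : k ≤ i := Nat.lt_succ_iff.1 (mem_range.1 hk)
    have hUk : 0 ≤ Uk k := (abs_nonneg _).trans (hU k hki)
    calc (i.choose k : ℝ) * ‖iteratedFDeriv ℝ k u θ‖ * ‖iteratedFDeriv ℝ (i - k) dir θ‖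
        ≤ (i.choose k : ℝ) * Uk k * 1 :=
          mul_le_mul (mul_le_mul_of_nonneg_left (hu_k k hki) (by positivity)) (norm_iteratedFDeriv_dir_le _ _)
            (norm_nonneg _) (by positivity)
      _ = (i.choose k : ℝ) * Uk k := mul_one _
  have hT2 : ‖T‖ ≤ 2 := norm_toLpCLM_le
  have hS : 0 ≤ ∑ k ∈ range (i + 1), (i.choose k : ℝ) * Uk k :=
    sum_nonneg fun k hk => mul_nonneg (by positivity) ((abs_nonneg _).trans (hU k (Nat.lt_succ_iff.1 (mem_range.1 hk))))
  exact mul_le_mul hT2 (hL.trans (sum_le_sum hterm)) (norm_nonneg _) (by norm_num)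

/-- **The four graded curve jets in closed form**: with `|u_K^{(k)}(θ)| ≤ U k` for `k ≤ 4`,
`‖γ′‖ ≤ 2(U 0 + U 1)`, `‖γ″‖ ≤ 2(U 0 + 2U 1 + U 2)`, `‖γ‴‖ ≤ 2(U 0 + 3U 1 + 3U 2 + U 3)`, `‖γ⁗‖ ≤ 2(U 0 + 4U 1 + 6U 2 + 4U 3 + U 4)` —
the hypothesis `hD` of `flowPiece_reading_remainder_jets_oneCall_bell` with these four right-hand sides as `D 1 … D 4`. -/
theorem fermiPointLp_graded_jets {θ : ℝ} {Uk : ℕ → ℝ}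
    (hU : ∀ k ≤ 4, |iteratedDeriv k (perturbedFermiRadius (fun p : Fin 2 → ℝ => -K.eval p) μ) θ| ≤ Uk k) :
    ‖iteratedDeriv 1 (fun θ : ℝ => (WithLp.toLp 2 (klFermiPoint μ K θ) : Momentum)) θ‖ ≤ 2 * (Uk 0 + Uk 1) ∧
    ‖iteratedDeriv 2 (fun θ : ℝ => (WithLp.toLp 2 (klFermiPoint μ K θ) : Momentum)) θ‖ ≤ 2 * (Uk 0 + 2 * Uk 1 + Uk 2) ∧
    ‖iteratedDeriv 3 (fun θ : ℝ => (WithLp.toLp 2 (klFermiPoint μ K θ) : Momentum)) θ‖ ≤ 2 * (Uk 0 + 3 * Uk 1 + 3 * Uk 2 + Uk 3) ∧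
    ‖iteratedDeriv 4 (fun θ : ℝ => (WithLp.toLp 2 (klFermiPoint μ K θ) : Momentum)) θ‖ ≤
      2 * (Uk 0 + 4 * Uk 1 + 6 * Uk 2 + 4 * Uk 3 + Uk 4) := by
  have h1 := norm_iteratedDeriv_fermiPointLp_le_perOrder B hA hADt hlo hhi (i := 1) (by norm_num) (fun k hk => hU k (by omega))
  have h2 := norm_iteratedDeriv_fermiPointLp_le_perOrder B hA hADt hlo hhi (i := 2) (by norm_num) (fun k hk => hU k (by omega))
  have h3 := norm_iteratedDeriv_fermiPointLp_le_perOrder B hA hADt hlo hhi (i := 3) (by norm_num) (fun k hk => hU k (by omega))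
  have h4 := norm_iteratedDeriv_fermiPointLp_le_perOrder B hA hADt hlo hhi (i := 4) le_rfl (fun k hk => hU k (by omega))
  simp only [sum_range_succ, sum_range_zero, zero_add] at h1 h2 h3 h4
  norm_num [Nat.choose] at h1 h2 h3 h4
  refine ⟨?_, by linarith [h2], by linarith [h3], by linarith [h4]⟩
  rw [iteratedDeriv_one]; linarith [h1]

/-- The same as a `∀ i, 1 ≤ i → i ≤ 4 → ‖γ^{(i)}(θ)‖ ≤ D i` hypothesis with the four closed forms packaged in one function. -/
theorem fermiPointLp_graded_jets_fun {θ : ℝ} {Uk : ℕ → ℝ}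
    (hU : ∀ k ≤ 4, |iteratedDeriv k (perturbedFermiRadius (fun p : Fin 2 → ℝ => -K.eval p) μ) θ| ≤ Uk k) :
    ∀ i, 1 ≤ i → i ≤ 4 → ‖iteratedDeriv i (fun θ : ℝ => (WithLp.toLp 2 (klFermiPoint μ K θ) : Momentum)) θ‖ ≤
      (fun i : ℕ => if i = 1 then 2 * (Uk 0 + Uk 1) else if i = 2 then 2 * (Uk 0 + 2 * Uk 1 + Uk 2)
        else if i = 3 then 2 * (Uk 0 + 3 * Uk 1 + 3 * Uk 2 + Uk 3) else 2 * (Uk 0 + 4 * Uk 1 + 6 * Uk 2 + 4 * Uk 3 + Uk 4)) i := by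
  obtain ⟨h1, h2, h3, h4⟩ := fermiPointLp_graded_jets B hA hADt hlo hhi hU
  intro i hi1 hi4
  interval_cases i
  · simpa using h1
  · simpa using h2
  · simpa using h3
  · simpa using h4

end Curve

end Summit.HubbardSuperconductivity.HubbardSuperconductivity.Theorems.PerturbedFermiCurve

end
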